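import Literature.Analysis.Fourier.RadialSchwartzInterpolationQExpansion
import Literature.Analysis.Fourier.RadialSchwartzInterpolation
import Literature.Analysis.Calculus.IteratedFDerivParametricIntegral
import Mathlib.Analysis.Distribution.SchwartzSpace.Basic
import HarnessLib

/-!
# CKMRV interpolation, step 8: the coefficient functions `aₙ(x)`, `bₙ(x)` are Schwartz

Support file for the proof of the Cohn–Kumar–Miller–Radchenko–Viazovska interpolation theorem
(`Literature/Analysis/Fourier/RadialSchwartzInterpolation.lean`). Continuing the first half of
CKMRV Theorem 3.1 (step 7 treated a single holomorphic `F : ℍ → ℂ`), we now let `F` depend on a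
parameter `x` in a real normed space `P` (in the application `P = ℝᵈ`) and prove the statement
"To check that the coefficients are radial Schwartz functions, we note that for any `y > 0`,
`aₙ(x) = ∫_{−1+iy}^{iy} (F(τ,x) − τ(F(τ+1,x) − F(τ,x))) e^{−2πinτ} dτ` (3.6) … We can take radial
derivatives in `x` under the integral sign … the radial seminorms … are all finite … Thus `aₙ` and
`bₙ` are Schwartz functions":

given `F : ℍ → P → ℂ` with every `F τ` smooth, all `x`-derivatives jointly continuous on
`ℍ × P`, every `F · x` holomorphic, the functional equation `F(τ+2) − 2F(τ+1) + F(τ) = 0`, the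
bounds (3) `‖x‖ᵏ ‖Dⁿₓ F(τ,x)‖ ≤ α Im(τ)^{−β} + γ|τ|^δ` (Fréchet derivatives in `x`) and (4)
`|F(τ,x)| ≤ α Im(τ)^{−β}`, `β > 0`, on `|Re τ| ≤ 1`, there are **Schwartz functions**
`aₙ, gₙ ∈ 𝓢(P, ℂ)` (`n ≥ 1`), of at most polynomial growth in `n` at every point, radial when the
`F τ` are, with `F(τ,x) = ∑_{n≥1} aₙ(x) qⁿ + τ ∑_{n≥1} gₙ(x) qⁿ` (`exists_schwartz_coefficients`).
The coefficient functions are the `q`-expansion coefficients of step 7, realised by the segment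
integrals (3.6)–(3.7) at height `y = 1`; smoothness and decay in `x` come from iterated
differentiation under the integral sign (the tree's
`Literature.Analysis.Calculus.contDiff_integral_of_dominated_iteratedFDeriv`).

Everything is proved; no named facts.

## References

* H. Cohn, A. Kumar, S. D. Miller, D. Radchenko, M. Viazovska, *Universal optimality of the `E₈`
  and Leech lattices and interpolation formulas*, Ann. of Math. 196 (2022), §3.1, Theorem 3.1,
  proof (eqs. (3.3)–(3.7) and the paragraph following them). [CohnEtAl2019]
-/

noncomputable section

open scoped Topology UpperHalfPlane Manifold Real SchwartzMap ContDiff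
open Filter Complex UpperHalfPlane Function MeasureTheory Set

namespace Literature.Analysis.Fourier

/-! ## Points of the segments `u + i`, `0 ≤ u ≤ 1` -/

/-- The point `u + i` of `ℍ` (the segment `Im τ = 1` carries the coefficient integrals
(3.6)–(3.7) at height `y = 1`). [folklore] -/
def segPt1 (u : ℝ) : ℍ := ⟨u + Complex.I, by simp⟩

/-- `Re (u + i) = u`. [folklore] -/
@[simp] theorem segPt1_re (u : ℝ) : (segPt1 u).re = u := by
  simp [segPt1, UpperHalfPlane.re]

/-- `Im (u + i) = 1`. [folklore] -/
@[simp] theorem segPt1_im (u : ℝ) : (segPt1 u).im = 1 := by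
  simp [segPt1, UpperHalfPlane.im]

/-- `↑(u + i) = u + i`. [folklore] -/
@[simp] theorem coe_segPt1 (u : ℝ) : (segPt1 u : ℂ) = u + Complex.I := rfl

/-- `u ↦ u + i` is continuous. [folklore] -/
theorem continuous_segPt1 : Continuous segPt1 := by
  have hc : Continuous fun u : ℝ => (u : ℂ) + Complex.I := by fun_prop
  exact continuous_induced_rng.2 hc

/-- `|u + i| ≤ |u| + 1`. [folklore] -/
theorem norm_coe_segPt1_le (u : ℝ) : ‖(segPt1 u : ℂ)‖ ≤ |u| + 1 := by
  rw [coe_segPt1]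
  refine (norm_add_le _ _).trans ?_
  simp [Complex.norm_real]

/-! ## The `q`-expansion coefficients as segment integrals -/

/-- The `q`-expansion coefficients of a `1`-periodic holomorphic function bounded at `i∞`, as
segment integrals at height `1`:
`coeff_n(f) = ∫₀¹ q(u+i)^{−n} f(u+i) du` (Mathlib's `qExpansion_coeff_eq_intervalIntegral`, tidied;
CKMRV (3.6)–(3.7) with `y = 1`). [folklore] -/
theorem qExpansion_coeff_eq_integral_seg {f : ℍ → ℂ} (hper : Periodic (f ∘ ofComplex) 1)
    (hhol : MDiff f) (hbdd : IsBoundedAtImInfty f) (n : ℕ) :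
    (qExpansion 1 f).coeff n =
      ∫ u in Ioc (0 : ℝ) 1, (Periodic.qParam 1 (segPt1 u))⁻¹ ^ n * f (segPt1 u) := by
  rw [qExpansion_coeff_eq_intervalIntegral one_pos hper hhol hbdd n one_pos,
    intervalIntegral.integral_of_le zero_le_one]
  simp only [Complex.ofReal_one, div_one, one_mul, UpperHalfPlane.coe_I]
  refine setIntegral_congr_fun measurableSet_Ioc fun u _ => ?_
  rw [one_div, inv_pow]
  rfl

/-! ## Strip bounds for `G` and `H` -/

variable {F : ℍ → ℂ}

/-- `1 +ᵥ ((−1) +ᵥ τ) = τ`. [folklore] -/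
theorem one_vadd_neg_one_vadd (τ : ℍ) : ((1 : ℝ) +ᵥ (((-1 : ℝ)) +ᵥ τ) : ℍ) = τ := by
  rw [vadd_vadd]; norm_num

/-- **Strip bound for `G`:** `‖G τ‖ ≤ 2α Im(τ)^{−β}` for `0 ≤ Re τ ≤ 1`. [cite: CohnEtAl2019, §3.1 (proof of Theorem 3.1)] -/
theorem norm_shiftDiff_le (hFE : ∀ τ : ℍ, F ((2 : ℝ) +ᵥ τ) - 2 * F ((1 : ℝ) +ᵥ τ) + F τ = 0)
    {α β : ℝ} (hstrip : ∀ τ : ℍ, |τ.re| ≤ 1 → ‖F τ‖ ≤ α * τ.im ^ (-β)) {τ : ℍ}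
    (h0 : 0 ≤ τ.re) (h1 : τ.re ≤ 1) : ‖shiftDiff F τ‖ ≤ 2 * α * τ.im ^ (-β) := by
  set σ : ℍ := ((-1 : ℝ)) +ᵥ τ with hσ
  have hσre : σ.re = τ.re - 1 := by simp [hσ, vadd_re]; ring
  have hσim : σ.im = τ.im := by simp [hσ, vadd_im]
  have hper : shiftDiff F τ = shiftDiff F σ := by
    rw [← shiftDiff_one_vadd hFE σ, one_vadd_neg_one_vadd]
  have hG : shiftDiff F σ = F τ - F σ := by
    simp only [shiftDiff, hσ, one_vadd_neg_one_vadd]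
  rw [hper, hG]
  have hτs : |τ.re| ≤ 1 := abs_le.2 ⟨by linarith, h1⟩
  have hσs : |σ.re| ≤ 1 := by rw [hσre]; exact abs_le.2 ⟨by linarith, by linarith⟩
  calc ‖F τ - F σ‖ ≤ ‖F τ‖ + ‖F σ‖ := norm_sub_le _ _
    _ ≤ α * τ.im ^ (-β) + α * σ.im ^ (-β) := add_le_add (hstrip τ hτs) (hstrip σ hσs)
    _ = 2 * α * τ.im ^ (-β) := by rw [hσim]; ring

/-- **Strip bound for `H`:** `‖H τ‖ ≤ 5α Im(τ)^{−β}` for `0 ≤ Re τ ≤ 1`, `Im τ ≤ 1`.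
[cite: CohnEtAl2019, §3.1 (proof of Theorem 3.1)] -/
theorem norm_shiftRem_le (hFE : ∀ τ : ℍ, F ((2 : ℝ) +ᵥ τ) - 2 * F ((1 : ℝ) +ᵥ τ) + F τ = 0)
    {α β : ℝ} (hstrip : ∀ τ : ℍ, |τ.re| ≤ 1 → ‖F τ‖ ≤ α * τ.im ^ (-β)) {τ : ℍ}
    (h0 : 0 ≤ τ.re) (h1 : τ.re ≤ 1) (him : τ.im ≤ 1) : ‖shiftRem F τ‖ ≤ 5 * α * τ.im ^ (-β) := by
  set σ : ℍ := ((-1 : ℝ)) +ᵥ τ with hσ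
  have hσre : σ.re = τ.re - 1 := by simp [hσ, vadd_re]; ring
  have hσim : σ.im = τ.im := by simp [hσ, vadd_im]
  have hper : shiftRem F τ = shiftRem F σ := by
    rw [← shiftRem_one_vadd hFE σ, one_vadd_neg_one_vadd]
  have hσs : |σ.re| ≤ 1 := by rw [hσre]; exact abs_le.2 ⟨by linarith, by linarith⟩
  have hα : 0 ≤ α * τ.im ^ (-β) := le_trans (norm_nonneg _) (by
    have := hstrip σ hσs; rwa [hσim] at this)
  have hGσ : ‖shiftDiff F σ‖ ≤ 2 * α * τ.im ^ (-β) := by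
    have hG : shiftDiff F σ = F τ - F σ := by simp only [shiftDiff, hσ, one_vadd_neg_one_vadd]
    have hτs : |τ.re| ≤ 1 := abs_le.2 ⟨by linarith, h1⟩
    rw [hG]
    calc ‖F τ - F σ‖ ≤ ‖F τ‖ + ‖F σ‖ := norm_sub_le _ _
      _ ≤ α * τ.im ^ (-β) + α * σ.im ^ (-β) := add_le_add (hstrip τ hτs) (hstrip σ hσs)
      _ = 2 * α * τ.im ^ (-β) := by rw [hσim]; ring
  have hnσ : ‖(σ : ℂ)‖ ≤ 2 := by
    refine (norm_le_abs_re_add_abs_im _).trans ?_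
    rw [UpperHalfPlane.coe_re, UpperHalfPlane.coe_im, hσre, hσim, abs_of_pos τ.im_pos]
    have : |τ.re - 1| ≤ 1 := abs_le.2 ⟨by linarith, by linarith⟩
    linarith
  rw [hper, shiftRem]
  calc ‖F σ - (σ : ℂ) * shiftDiff F σ‖ ≤ ‖F σ‖ + ‖(σ : ℂ)‖ * ‖shiftDiff F σ‖ := by
        refine (norm_sub_le _ _).trans ?_; rw [norm_mul]
    _ ≤ α * σ.im ^ (-β) + 2 * (2 * α * τ.im ^ (-β)) :=
        add_le_add (hstrip σ hσs) (mul_le_mul hnσ hGσ (norm_nonneg _) zero_le_two)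
    _ = 5 * α * τ.im ^ (-β) := by rw [hσim]; ring

/-! ## The coefficient kernels and the coefficient functions -/

/-- `1 +ᵥ (u + it) = (u + 1) + it`. [folklore] -/
theorem one_vadd_segPt1 (u : ℝ) : ((1 : ℝ) +ᵥ segPt1 u : ℍ) = segPt1 (u + 1) := by
  ext1
  simp [coe_vadd, segPt1]
  ring

/-- The prefactor `q(u + i)^{−n}`, `q = e^{2πiτ}`, of the coefficient integrals. [folklore] -/
def qInvPow (n : ℕ) (u : ℝ) : ℂ := (Periodic.qParam 1 (segPt1 u))⁻¹ ^ n

/-- `‖q(u+i)^{−n}‖ = e^{2πn}`. [folklore] -/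
theorem norm_qInvPow (n : ℕ) (u : ℝ) : ‖qInvPow n u‖ = Real.exp (2 * π * n) := by
  rw [qInvPow, norm_pow, norm_inv, Periodic.norm_qParam, coe_segPt1]
  have him : ((u : ℂ) + Complex.I).im = 1 := by simp
  rw [him, div_one, ← Real.exp_neg, ← Real.exp_nat_mul]
  congr 1; ring

/-- `u ↦ q(u+i)^{−n}` is continuous. [folklore] -/
theorem continuous_qInvPow (n : ℕ) : Continuous (qInvPow n) := by
  unfold qInvPow
  refine ((Periodic.continuous_qParam.comp (continuous_induced_dom.comp
    (continuous_segPt1))).inv₀ fun u => Periodic.qParam_ne_zero _).pow n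

variable {P : Type*}

/-- **The kernel of (3.6)** at height `y = 1`, as a function of `x`:
`u ↦ q(u+i)^{−n} (F(σ,·) − σ (F(σ+1,·) − F(σ,·)))`, `σ = u + i`. [cite: CohnEtAl2019, §3.1 (3.6)] -/
def coeffKernelA (F : ℍ → P → ℂ) (n : ℕ) (u : ℝ) : P → ℂ :=
  qInvPow n u • (F (segPt1 u) -
    ((segPt1 u : ℂ)) • (F (segPt1 (u + 1)) - F (segPt1 u)))

/-- **The kernel of (3.7)** at height `y = 1`: `u ↦ q(u+i)^{−n} (F(σ+1,·) − F(σ,·))`.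
[cite: CohnEtAl2019, §3.1 (3.7)] -/
def coeffKernelG (F : ℍ → P → ℂ) (n : ℕ) (u : ℝ) : P → ℂ :=
  qInvPow n u • (F (segPt1 (u + 1)) - F (segPt1 u))

/-- The kernel of (3.6) is `q^{−n} H_x(σ)`. [folklore] -/
theorem coeffKernelA_apply (F : ℍ → P → ℂ) (n : ℕ) (u : ℝ) (x : P) :
    coeffKernelA F n u x = qInvPow n u * shiftRem (fun τ => F τ x) (segPt1 u) := by
  simp only [coeffKernelA, shiftRem, shiftDiff, one_vadd_segPt1, Pi.smul_apply, Pi.sub_apply,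
    smul_eq_mul]

/-- The kernel of (3.7) is `q^{−n} G_x(σ)`. [folklore] -/
theorem coeffKernelG_apply (F : ℍ → P → ℂ) (n : ℕ) (u : ℝ) (x : P) :
    coeffKernelG F n u x = qInvPow n u * shiftDiff (fun τ => F τ x) (segPt1 u) := by
  simp only [coeffKernelG, shiftDiff, one_vadd_segPt1, Pi.smul_apply, Pi.sub_apply, smul_eq_mul]

/-- **The coefficient function `aₙ` of (3.5)–(3.6)** (at `y = 1`):
`aₙ(x) = ∫₀¹ q(u+i)^{−n} H_x(u+i) du`. [cite: CohnEtAl2019, §3.1 (3.6)] -/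
def coeffA (F : ℍ → P → ℂ) (n : ℕ) (x : P) : ℂ := ∫ u in Ioc (0 : ℝ) 1, coeffKernelA F n u x

/-- **The coefficient function `gₙ = 2πi√(2n) bₙ` of (3.4), (3.7)** (at `y = 1`):
`gₙ(x) = ∫₀¹ q(u+i)^{−n} G_x(u+i) du`. [cite: CohnEtAl2019, §3.1 (3.7)] -/
def coeffG (F : ℍ → P → ℂ) (n : ℕ) (x : P) : ℂ := ∫ u in Ioc (0 : ℝ) 1, coeffKernelG F n u x

variable {Fp : ℍ → P → ℂ}

/-- `aₙ(x)` is the `n`-th `q`-expansion coefficient of `H_x`. [folklore] -/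
theorem coeffA_eq_qExpansion_coeff (hh : ∀ x, MDiff fun τ => Fp τ x)
    (hFE : ∀ τ x, Fp ((2 : ℝ) +ᵥ τ) x - 2 * Fp ((1 : ℝ) +ᵥ τ) x + Fp τ x = 0)
    {α β : ℝ} (hβ : 0 < β) (h4 : ∀ τ x, |τ.re| ≤ 1 → ‖Fp τ x‖ ≤ α * τ.im ^ (-β)) (n : ℕ) (x : P) :
    coeffA Fp n x = (qExpansion 1 (shiftRem (fun τ => Fp τ x))).coeff n := by
  have hFEx : ∀ τ : ℍ, Fp ((2 : ℝ) +ᵥ τ) x - 2 * Fp ((1 : ℝ) +ᵥ τ) x + Fp τ x = 0 := fun τ => hFE τ x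
  rw [qExpansion_coeff_eq_integral_seg (periodic_shiftRem hFEx) (mdifferentiable_shiftRem (hh x))
    (isZeroAtImInfty_shiftRem (hh x) hFEx hβ (fun τ hτ => h4 τ x hτ)).isBoundedAtImInfty]
  simp only [coeffA, coeffKernelA_apply, qInvPow]

/-- `gₙ(x)` is the `n`-th `q`-expansion coefficient of `G_x`. [folklore] -/
theorem coeffG_eq_qExpansion_coeff (hh : ∀ x, MDiff fun τ => Fp τ x)
    (hFE : ∀ τ x, Fp ((2 : ℝ) +ᵥ τ) x - 2 * Fp ((1 : ℝ) +ᵥ τ) x + Fp τ x = 0)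
    {α β : ℝ} (hβ : 0 < β) (h4 : ∀ τ x, |τ.re| ≤ 1 → ‖Fp τ x‖ ≤ α * τ.im ^ (-β)) (n : ℕ) (x : P) :
    coeffG Fp n x = (qExpansion 1 (shiftDiff (fun τ => Fp τ x))).coeff n := by
  have hFEx : ∀ τ : ℍ, Fp ((2 : ℝ) +ᵥ τ) x - 2 * Fp ((1 : ℝ) +ᵥ τ) x + Fp τ x = 0 := fun τ => hFE τ x
  rw [qExpansion_coeff_eq_integral_seg (periodic_shiftDiff hFEx) (mdifferentiable_shiftDiff (hh x))
    (isZeroAtImInfty_shiftDiff hFEx hβ (fun τ hτ => h4 τ x hτ)).isBoundedAtImInfty]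
  simp only [coeffG, coeffKernelG_apply, qInvPow]

/-! ## Differentiating the kernels in `x` -/

section Calculus

variable [NormedAddCommGroup P] [NormedSpace ℝ P]

/-- The iterated `x`-derivatives of the kernel of (3.6). [folklore] -/
theorem iteratedFDeriv_coeffKernelA (hs : ∀ τ, ContDiff ℝ ∞ (Fp τ)) (n m : ℕ) (u : ℝ) (x : P) :
    iteratedFDeriv ℝ m (coeffKernelA Fp n u) x =
      qInvPow n u • (iteratedFDeriv ℝ m (Fp (segPt1 u)) x -
        ((segPt1 u : ℂ)) • (iteratedFDeriv ℝ m (Fp (segPt1 (u + 1))) x -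
          iteratedFDeriv ℝ m (Fp (segPt1 u)) x)) := by
  have h1 : ∀ τ, ContDiffAt ℝ m (Fp τ) x := fun τ => ((hs τ).of_le (mod_cast le_top)).contDiffAt
  have h2 : ContDiffAt ℝ m (Fp (segPt1 (u + 1)) - Fp (segPt1 u)) x :=
    (h1 _).sub (h1 _)
  have h3 : ContDiffAt ℝ m (((segPt1 u : ℂ)) •
      (Fp (segPt1 (u + 1)) - Fp (segPt1 u))) x := contDiffAt_const.smul h2
  have h4 : ContDiffAt ℝ m (Fp (segPt1 u) - ((segPt1 u : ℂ)) •
      (Fp (segPt1 (u + 1)) - Fp (segPt1 u))) x := (h1 _).sub h3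
  rw [coeffKernelA, iteratedFDeriv_const_smul_apply h4, iteratedFDeriv_sub_apply (h1 _) h3,
    iteratedFDeriv_const_smul_apply h2, iteratedFDeriv_sub_apply (h1 _) (h1 _)]

/-- The iterated `x`-derivatives of the kernel of (3.7). [folklore] -/
theorem iteratedFDeriv_coeffKernelG (hs : ∀ τ, ContDiff ℝ ∞ (Fp τ)) (n m : ℕ) (u : ℝ) (x : P) :
    iteratedFDeriv ℝ m (coeffKernelG Fp n u) x =
      qInvPow n u • (iteratedFDeriv ℝ m (Fp (segPt1 (u + 1))) x -
        iteratedFDeriv ℝ m (Fp (segPt1 u)) x) := by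
  have h1 : ∀ τ, ContDiffAt ℝ m (Fp τ) x := fun τ => ((hs τ).of_le (mod_cast le_top)).contDiffAt
  have h2 : ContDiffAt ℝ m (Fp (segPt1 (u + 1)) - Fp (segPt1 u)) x := (h1 _).sub (h1 _)
  rw [coeffKernelG, iteratedFDeriv_const_smul_apply h2, iteratedFDeriv_sub_apply (h1 _) (h1 _)]

/-- The kernels are smooth in `x`. [folklore] -/
theorem contDiff_coeffKernelA (hs : ∀ τ, ContDiff ℝ ∞ (Fp τ)) (n : ℕ) (u : ℝ) :
    ContDiff ℝ ∞ (coeffKernelA Fp n u) :=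
  contDiff_const.smul ((hs _).sub (contDiff_const.smul ((hs _).sub (hs _))))

/-- The kernels are smooth in `x`. [folklore] -/
theorem contDiff_coeffKernelG (hs : ∀ τ, ContDiff ℝ ∞ (Fp τ)) (n : ℕ) (u : ℝ) :
    ContDiff ℝ ∞ (coeffKernelG Fp n u) :=
  contDiff_const.smul ((hs _).sub (hs _))

/-- Continuity in `u` of the `x`-derivatives of the kernels (from the joint continuity of the
`x`-derivatives of `F`). [folklore] -/
theorem continuous_iteratedFDeriv_coeffKernelA (hs : ∀ τ, ContDiff ℝ ∞ (Fp τ))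
    (hc : ∀ m : ℕ, Continuous fun q : ℍ × P => iteratedFDeriv ℝ m (Fp q.1) q.2) (n m : ℕ) (x : P) :
    Continuous fun u : ℝ => iteratedFDeriv ℝ m (coeffKernelA Fp n u) x := by
  simp only [iteratedFDeriv_coeffKernelA hs]
  have hD : ∀ v : ℝ → ℝ, Continuous v →
      Continuous fun u : ℝ => iteratedFDeriv ℝ m (Fp (segPt1 (v u))) x := fun v hv =>
    (hc m).comp ((continuous_segPt1.comp hv).prodMk continuous_const)
  have hσ : Continuous fun u : ℝ => ((segPt1 u : ℂ)) :=
    continuous_induced_dom.comp continuous_segPt1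
  exact (continuous_qInvPow n).smul ((hD id continuous_id).sub
    (hσ.smul ((hD _ (continuous_id.add continuous_const)).sub (hD id continuous_id))))

/-- Continuity in `u` of the `x`-derivatives of the kernel of (3.7). [folklore] -/
theorem continuous_iteratedFDeriv_coeffKernelG (hs : ∀ τ, ContDiff ℝ ∞ (Fp τ))
    (hc : ∀ m : ℕ, Continuous fun q : ℍ × P => iteratedFDeriv ℝ m (Fp q.1) q.2) (n m : ℕ) (x : P) :
    Continuous fun u : ℝ => iteratedFDeriv ℝ m (coeffKernelG Fp n u) x := by
  simp only [iteratedFDeriv_coeffKernelG hs]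
  have hD : ∀ v : ℝ → ℝ, Continuous v →
      Continuous fun u : ℝ => iteratedFDeriv ℝ m (Fp (segPt1 (v u))) x := fun v hv =>
    (hc m).comp ((continuous_segPt1.comp hv).prodMk continuous_const)
  exact (continuous_qInvPow n).smul ((hD _ (continuous_id.add continuous_const)).sub (hD id continuous_id))

/-- **Weighted bounds for the `x`-derivatives of the kernels:** from the bound (3) with weight
`‖x‖ᵏ`, `‖x‖ᵏ ‖Dᵐₓ K(u,·)(x)‖ ≤ e^{2πn} (3 + 2|u|) (α + γ (|u| + 2)^δ)` for all `u`, `x`.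
[folklore] -/
theorem pow_mul_norm_iteratedFDeriv_coeffKernelA_le (hs : ∀ τ, ContDiff ℝ ∞ (Fp τ)) {k m : ℕ}
    {α β γ δ : ℝ} (hα : 0 ≤ α) (hγ : 0 ≤ γ) (hδ : 0 ≤ δ)
    (h3 : ∀ τ x, ‖x‖ ^ k * ‖iteratedFDeriv ℝ m (Fp τ) x‖ ≤ α * τ.im ^ (-β) + γ * ‖(τ : ℂ)‖ ^ δ)
    (n : ℕ) (u : ℝ) (x : P) :
    ‖x‖ ^ k * ‖iteratedFDeriv ℝ m (coeffKernelA Fp n u) x‖ ≤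
      Real.exp (2 * π * n) * ((3 + 2 * |u|) * (α + γ * (|u| + 2) ^ δ)) := by
  set σ := segPt1 u with hσ
  set σ' := segPt1 (u + 1) with hσ'
  have hB : ∀ v : ℝ, ‖x‖ ^ k * ‖iteratedFDeriv ℝ m (Fp (segPt1 v)) x‖ ≤ α + γ * (|v| + 1) ^ δ := by
    intro v
    refine (h3 _ x).trans ?_
    rw [segPt1_im, Real.one_rpow, mul_one]
    refine add_le_add le_rfl (mul_le_mul_of_nonneg_left ?_ hγ)
    exact Real.rpow_le_rpow (norm_nonneg _) (norm_coe_segPt1_le v) hδ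
  have hB0 : ‖x‖ ^ k * ‖iteratedFDeriv ℝ m (Fp σ) x‖ ≤ α + γ * (|u| + 2) ^ δ := by
    refine (hB u).trans (add_le_add le_rfl (mul_le_mul_of_nonneg_left ?_ hγ))
    exact Real.rpow_le_rpow (by positivity) (by linarith) hδ
  have hB1 : ‖x‖ ^ k * ‖iteratedFDeriv ℝ m (Fp σ') x‖ ≤ α + γ * (|u| + 2) ^ δ := by
    refine (hB (u + 1)).trans (add_le_add le_rfl (mul_le_mul_of_nonneg_left ?_ hγ))
    exact Real.rpow_le_rpow (by positivity) (by linarith [abs_add_le u 1, abs_one (α := ℝ)]) hδ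
  have hnσ : ‖(σ : ℂ)‖ ≤ |u| + 1 := norm_coe_segPt1_le u
  set B := α + γ * (|u| + 2) ^ δ with hBdef
  have hBnn : 0 ≤ B := by positivity
  rw [iteratedFDeriv_coeffKernelA hs, norm_smul, norm_qInvPow]
  rw [mul_left_comm]
  refine mul_le_mul_of_nonneg_left ?_ (Real.exp_pos _).le
  calc ‖x‖ ^ k * ‖iteratedFDeriv ℝ m (Fp σ) x - (σ : ℂ) • (iteratedFDeriv ℝ m (Fp σ') x -
        iteratedFDeriv ℝ m (Fp σ) x)‖
      ≤ ‖x‖ ^ k * (‖iteratedFDeriv ℝ m (Fp σ) x‖ + ‖(σ : ℂ)‖ * (‖iteratedFDeriv ℝ m (Fp σ') x‖ +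
          ‖iteratedFDeriv ℝ m (Fp σ) x‖)) := by
        refine mul_le_mul_of_nonneg_left ((norm_sub_le _ _).trans (add_le_add le_rfl ?_)) (by positivity)
        rw [norm_smul]
        exact mul_le_mul_of_nonneg_left (norm_sub_le _ _) (norm_nonneg _)
    _ = ‖x‖ ^ k * ‖iteratedFDeriv ℝ m (Fp σ) x‖ + ‖(σ : ℂ)‖ * (‖x‖ ^ k * ‖iteratedFDeriv ℝ m (Fp σ') x‖ +
          ‖x‖ ^ k * ‖iteratedFDeriv ℝ m (Fp σ) x‖) := by ring
    _ ≤ B + (|u| + 1) * (B + B) :=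
        add_le_add hB0 (mul_le_mul hnσ (add_le_add hB1 hB0) (by positivity) (by positivity))
    _ = (3 + 2 * |u|) * B := by ring

/-- Weighted bounds for the `x`-derivatives of the kernel of (3.7):
`‖x‖ᵏ ‖Dᵐₓ K(u,·)(x)‖ ≤ e^{2πn} · 2 (α + γ (|u| + 2)^δ)`. [folklore] -/
theorem pow_mul_norm_iteratedFDeriv_coeffKernelG_le (hs : ∀ τ, ContDiff ℝ ∞ (Fp τ)) {k m : ℕ}
    {α β γ δ : ℝ} (hγ : 0 ≤ γ) (hδ : 0 ≤ δ)
    (h3 : ∀ τ x, ‖x‖ ^ k * ‖iteratedFDeriv ℝ m (Fp τ) x‖ ≤ α * τ.im ^ (-β) + γ * ‖(τ : ℂ)‖ ^ δ)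
    (n : ℕ) (u : ℝ) (x : P) :
    ‖x‖ ^ k * ‖iteratedFDeriv ℝ m (coeffKernelG Fp n u) x‖ ≤
      Real.exp (2 * π * n) * (2 * (α + γ * (|u| + 2) ^ δ)) := by
  have hB : ∀ v : ℝ, ‖x‖ ^ k * ‖iteratedFDeriv ℝ m (Fp (segPt1 v)) x‖ ≤ α + γ * (|v| + 1) ^ δ := by
    intro v
    refine (h3 _ x).trans ?_
    rw [segPt1_im, Real.one_rpow, mul_one]
    refine add_le_add le_rfl (mul_le_mul_of_nonneg_left ?_ hγ)
    exact Real.rpow_le_rpow (norm_nonneg _) (norm_coe_segPt1_le v) hδ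
  have hB0 : ‖x‖ ^ k * ‖iteratedFDeriv ℝ m (Fp (segPt1 u)) x‖ ≤ α + γ * (|u| + 2) ^ δ := by
    refine (hB u).trans (add_le_add le_rfl (mul_le_mul_of_nonneg_left ?_ hγ))
    exact Real.rpow_le_rpow (by positivity) (by linarith) hδ
  have hB1 : ‖x‖ ^ k * ‖iteratedFDeriv ℝ m (Fp (segPt1 (u + 1))) x‖ ≤ α + γ * (|u| + 2) ^ δ := by
    refine (hB (u + 1)).trans (add_le_add le_rfl (mul_le_mul_of_nonneg_left ?_ hγ))
    exact Real.rpow_le_rpow (by positivity) (by linarith [abs_add_le u 1, abs_one (α := ℝ)]) hδ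
  rw [iteratedFDeriv_coeffKernelG hs, norm_smul, norm_qInvPow, mul_left_comm]
  refine mul_le_mul_of_nonneg_left ?_ (Real.exp_pos _).le
  calc ‖x‖ ^ k * ‖iteratedFDeriv ℝ m (Fp (segPt1 (u + 1))) x -
        iteratedFDeriv ℝ m (Fp (segPt1 u)) x‖
      ≤ ‖x‖ ^ k * ‖iteratedFDeriv ℝ m (Fp (segPt1 (u + 1))) x‖ +
          ‖x‖ ^ k * ‖iteratedFDeriv ℝ m (Fp (segPt1 u)) x‖ := by
        rw [← mul_add]; exact mul_le_mul_of_nonneg_left (norm_sub_le _ _) (by positivity)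
    _ ≤ (α + γ * (|u| + 2) ^ δ) + (α + γ * (|u| + 2) ^ δ) := add_le_add hB1 hB0
    _ = 2 * (α + γ * (|u| + 2) ^ δ) := by ring

/-! ## The coefficient functions are Schwartz -/

/-- A continuous real function is integrable on `(0, 1]`. [folklore] -/
theorem integrableOn_Ioc_of_continuous {g : ℝ → ℝ} (hg : Continuous g) :
    Integrable g ((volume : Measure ℝ).restrict (Ioc (0 : ℝ) 1)) :=
  (hg.integrableOn_Icc (a := 0) (b := 1)).mono_set Ioc_subset_Icc_self

/-- The dominating functions are continuous. [folklore] -/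
theorem continuous_bound (c a γ δ : ℝ) :
    Continuous fun u : ℝ => c * ((3 + 2 * |u|) * (a + γ * (|u| + 2) ^ δ)) := by
  have h : ∀ u : ℝ, 0 < |u| + 2 := fun u => by positivity
  refine continuous_const.mul ((continuous_const.add (continuous_const.mul continuous_abs)).mul
    (continuous_const.add (continuous_const.mul ?_)))
  exact Continuous.rpow_const (continuous_abs.add continuous_const) fun u => Or.inl (h u).ne'

/-- The dominating functions are continuous (kernel of (3.7)). [folklore] -/
theorem continuous_bound' (c a γ δ : ℝ) :
    Continuous fun u : ℝ => c * (2 * (a + γ * (|u| + 2) ^ δ)) := by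
  have h : ∀ u : ℝ, 0 < |u| + 2 := fun u => by positivity
  refine continuous_const.mul (continuous_const.mul (continuous_const.add (continuous_const.mul ?_)))
  exact Continuous.rpow_const (continuous_abs.add continuous_const) fun u => Or.inl (h u).ne'

/-- The standing hypothesis (3) of CKMRV Theorem 3.1, Fréchet form: for all `k, m` there are
`α, β, γ, δ` (`α, γ, δ ≥ 0`) with `‖x‖ᵏ ‖Dᵐₓ F(τ,x)‖ ≤ α Im(τ)^{−β} + γ |τ|^δ`. [cite: CohnEtAl2019, §3.1 Theorem 3.1 (3)] -/
def HasGrowthBounds (Fp : ℍ → P → ℂ) : Prop :=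
  ∀ k m : ℕ, ∃ α β γ δ : ℝ, 0 ≤ α ∧ 0 ≤ γ ∧ 0 ≤ δ ∧
    ∀ (τ : ℍ) (x : P), ‖x‖ ^ k * ‖iteratedFDeriv ℝ m (Fp τ) x‖ ≤ α * τ.im ^ (-β) + γ * ‖(τ : ℂ)‖ ^ δ

/-- **`aₙ` is a Schwartz function** (CKMRV: "We can take radial derivatives in `x` under the
integral sign … the radial seminorms … are all finite … Thus `aₙ` and `bₙ` are Schwartz
functions"): the coefficient function `aₙ = ∫₀¹ q^{−n} H_x(u+i) du`, bundled, for `F` with smooth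
fibres, jointly continuous `x`-derivatives and the bounds (3). [cite: CohnEtAl2019, §3.1 (proof of Theorem 3.1)] -/
def coeffASchwartz (hs : ∀ τ, ContDiff ℝ ∞ (Fp τ))
    (hc : ∀ m : ℕ, Continuous fun q : ℍ × P => iteratedFDeriv ℝ m (Fp q.1) q.2)
    (h3 : HasGrowthBounds Fp) (n : ℕ) : 𝓢(P, ℂ) where
  toFun := coeffA Fp n
  smooth' := by
    refine Calculus.contDiff_integral_of_dominated_iteratedFDeriv (contDiff_coeffKernelA hs n)
      (fun m x => (continuous_iteratedFDeriv_coeffKernelA hs hc n m x).aestronglyMeasurable) fun m => ?_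
    obtain ⟨α, β, γ, δ, hα, hγ, hδ, hb⟩ := h3 0 m
    refine ⟨_, integrableOn_Ioc_of_continuous (continuous_bound (Real.exp (2 * π * n)) α γ δ),
      fun u x => ?_⟩
    have h := pow_mul_norm_iteratedFDeriv_coeffKernelA_le hs hα hγ hδ hb n u x
    rwa [pow_zero, one_mul] at h
  decay' := by
    intro k m
    obtain ⟨α, β, γ, δ, hα, hγ, hδ, hb⟩ := h3 k m
    set g : ℝ → ℝ := fun u => Real.exp (2 * π * n) * ((3 + 2 * |u|) * (α + γ * (|u| + 2) ^ δ)) with hg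
    refine ⟨∫ u in Ioc (0 : ℝ) 1, g u, fun x => ?_⟩
    have hformula := Calculus.iteratedFDeriv_integral_eq (μ := (volume : Measure ℝ).restrict (Ioc 0 1))
      (contDiff_coeffKernelA hs n)
      (fun m x => (continuous_iteratedFDeriv_coeffKernelA hs hc n m x).aestronglyMeasurable)
      (fun m => by
        obtain ⟨α', β', γ', δ', hα', hγ', hδ', hb'⟩ := h3 0 m
        refine ⟨_, integrableOn_Ioc_of_continuous (continuous_bound (Real.exp (2 * π * n)) α' γ' δ'),
          fun u x => ?_⟩
        have h := pow_mul_norm_iteratedFDeriv_coeffKernelA_le hs hα' hγ' hδ' hb' n u x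
        rwa [pow_zero, one_mul] at h) m x
    change ‖x‖ ^ k * ‖iteratedFDeriv ℝ m (fun x => ∫ u in Ioc (0 : ℝ) 1, coeffKernelA Fp n u x) x‖ ≤ _
    rw [hformula]
    calc ‖x‖ ^ k * ‖∫ u in Ioc (0 : ℝ) 1, iteratedFDeriv ℝ m (coeffKernelA Fp n u) x‖
        ≤ ‖x‖ ^ k * ∫ u in Ioc (0 : ℝ) 1, ‖iteratedFDeriv ℝ m (coeffKernelA Fp n u) x‖ :=
          mul_le_mul_of_nonneg_left (norm_integral_le_integral_norm _) (by positivity)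
      _ = ∫ u in Ioc (0 : ℝ) 1, ‖x‖ ^ k * ‖iteratedFDeriv ℝ m (coeffKernelA Fp n u) x‖ :=
          (integral_const_mul _ _).symm
      _ ≤ ∫ u in Ioc (0 : ℝ) 1, g u :=
          integral_mono_of_nonneg (Eventually.of_forall fun u => by positivity)
            (integrableOn_Ioc_of_continuous (continuous_bound (Real.exp (2 * π * n)) α γ δ))
            (Eventually.of_forall fun u => pow_mul_norm_iteratedFDeriv_coeffKernelA_le hs hα hγ hδ hb n u x)

/-- Values of `aₙ` as a Schwartz function. [folklore] -/
@[simp]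
theorem coeffASchwartz_apply (hs : ∀ τ, ContDiff ℝ ∞ (Fp τ))
    (hc : ∀ m : ℕ, Continuous fun q : ℍ × P => iteratedFDeriv ℝ m (Fp q.1) q.2)
    (h3 : HasGrowthBounds Fp) (n : ℕ) (x : P) : coeffASchwartz hs hc h3 n x = coeffA Fp n x := rfl

/-- **`gₙ` (`= 2πi√(2n) bₙ`) is a Schwartz function.** [cite: CohnEtAl2019, §3.1 (proof of Theorem 3.1)] -/
def coeffGSchwartz (hs : ∀ τ, ContDiff ℝ ∞ (Fp τ))
    (hc : ∀ m : ℕ, Continuous fun q : ℍ × P => iteratedFDeriv ℝ m (Fp q.1) q.2)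
    (h3 : HasGrowthBounds Fp) (n : ℕ) : 𝓢(P, ℂ) where
  toFun := coeffG Fp n
  smooth' := by
    refine Calculus.contDiff_integral_of_dominated_iteratedFDeriv (contDiff_coeffKernelG hs n)
      (fun m x => (continuous_iteratedFDeriv_coeffKernelG hs hc n m x).aestronglyMeasurable) fun m => ?_
    obtain ⟨α, β, γ, δ, hα, hγ, hδ, hb⟩ := h3 0 m
    refine ⟨_, integrableOn_Ioc_of_continuous (continuous_bound' (Real.exp (2 * π * n)) α γ δ),
      fun u x => ?_⟩
    have h := pow_mul_norm_iteratedFDeriv_coeffKernelG_le hs hγ hδ hb n u x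
    rwa [pow_zero, one_mul] at h
  decay' := by
    intro k m
    obtain ⟨α, β, γ, δ, hα, hγ, hδ, hb⟩ := h3 k m
    set g : ℝ → ℝ := fun u => Real.exp (2 * π * n) * (2 * (α + γ * (|u| + 2) ^ δ)) with hg
    refine ⟨∫ u in Ioc (0 : ℝ) 1, g u, fun x => ?_⟩
    have hformula := Calculus.iteratedFDeriv_integral_eq (μ := (volume : Measure ℝ).restrict (Ioc 0 1))
      (contDiff_coeffKernelG hs n)
      (fun m x => (continuous_iteratedFDeriv_coeffKernelG hs hc n m x).aestronglyMeasurable)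
      (fun m => by
        obtain ⟨α', β', γ', δ', hα', hγ', hδ', hb'⟩ := h3 0 m
        refine ⟨_, integrableOn_Ioc_of_continuous (continuous_bound' (Real.exp (2 * π * n)) α' γ' δ'),
          fun u x => ?_⟩
        have h := pow_mul_norm_iteratedFDeriv_coeffKernelG_le hs hγ' hδ' hb' n u x
        rwa [pow_zero, one_mul] at h) m x
    change ‖x‖ ^ k * ‖iteratedFDeriv ℝ m (fun x => ∫ u in Ioc (0 : ℝ) 1, coeffKernelG Fp n u x) x‖ ≤ _
    rw [hformula]
    calc ‖x‖ ^ k * ‖∫ u in Ioc (0 : ℝ) 1, iteratedFDeriv ℝ m (coeffKernelG Fp n u) x‖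
        ≤ ‖x‖ ^ k * ∫ u in Ioc (0 : ℝ) 1, ‖iteratedFDeriv ℝ m (coeffKernelG Fp n u) x‖ :=
          mul_le_mul_of_nonneg_left (norm_integral_le_integral_norm _) (by positivity)
      _ = ∫ u in Ioc (0 : ℝ) 1, ‖x‖ ^ k * ‖iteratedFDeriv ℝ m (coeffKernelG Fp n u) x‖ :=
          (integral_const_mul _ _).symm
      _ ≤ ∫ u in Ioc (0 : ℝ) 1, g u :=
          integral_mono_of_nonneg (Eventually.of_forall fun u => by positivity)
            (integrableOn_Ioc_of_continuous (continuous_bound' (Real.exp (2 * π * n)) α γ δ))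
            (Eventually.of_forall fun u => pow_mul_norm_iteratedFDeriv_coeffKernelG_le hs hγ hδ hb n u x)

/-- Values of `gₙ` as a Schwartz function. [folklore] -/
@[simp]
theorem coeffGSchwartz_apply (hs : ∀ τ, ContDiff ℝ ∞ (Fp τ))
    (hc : ∀ m : ℕ, Continuous fun q : ℍ × P => iteratedFDeriv ℝ m (Fp q.1) q.2)
    (h3 : HasGrowthBounds Fp) (n : ℕ) (x : P) : coeffGSchwartz hs hc h3 n x = coeffG Fp n x := rfl

/-! ## Polynomial growth and radiality of the coefficients -/

omit [NormedAddCommGroup P] [NormedSpace ℝ P] in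
/-- **Polynomial growth of `aₙ(x)`:** `‖aₙ(x)‖ ≤ 5 e^{2π} α nᵝ` for `n ≥ 1`. [cite: CohnEtAl2019, §3.1 (proof of Theorem 3.1)] -/
theorem norm_coeffA_le (hh : ∀ x, MDiff fun τ => Fp τ x)
    (hFE : ∀ τ x, Fp ((2 : ℝ) +ᵥ τ) x - 2 * Fp ((1 : ℝ) +ᵥ τ) x + Fp τ x = 0)
    {α β : ℝ} (hβ : 0 < β) (h4 : ∀ τ x, |τ.re| ≤ 1 → ‖Fp τ x‖ ≤ α * τ.im ^ (-β)) {n : ℕ} (hn : 1 ≤ n)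
    (x : P) : ‖coeffA Fp n x‖ ≤ Real.exp (2 * π) * (5 * α) * (n : ℝ) ^ β := by
  have hFEx : ∀ τ : ℍ, Fp ((2 : ℝ) +ᵥ τ) x - 2 * Fp ((1 : ℝ) +ᵥ τ) x + Fp τ x = 0 := fun τ => hFE τ x
  have h4x : ∀ τ : ℍ, |τ.re| ≤ 1 → ‖Fp τ x‖ ≤ α * τ.im ^ (-β) := fun τ hτ => h4 τ x hτ
  rw [coeffA_eq_qExpansion_coeff hh hFE hβ h4]
  exact norm_qExpansion_coeff_le_of_strip (periodic_shiftRem hFEx) (mdifferentiable_shiftRem (hh x))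
    (isZeroAtImInfty_shiftRem (hh x) hFEx hβ h4x).isBoundedAtImInfty
    (fun τ h0 h1 him => by
      have := norm_shiftRem_le hFEx h4x h0 h1 him
      linarith) hn

omit [NormedAddCommGroup P] [NormedSpace ℝ P] in
/-- **Polynomial growth of `gₙ(x)`:** `‖gₙ(x)‖ ≤ 2 e^{2π} α nᵝ` for `n ≥ 1`. [cite: CohnEtAl2019, §3.1 (proof of Theorem 3.1)] -/
theorem norm_coeffG_le (hh : ∀ x, MDiff fun τ => Fp τ x)
    (hFE : ∀ τ x, Fp ((2 : ℝ) +ᵥ τ) x - 2 * Fp ((1 : ℝ) +ᵥ τ) x + Fp τ x = 0)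
    {α β : ℝ} (hβ : 0 < β) (h4 : ∀ τ x, |τ.re| ≤ 1 → ‖Fp τ x‖ ≤ α * τ.im ^ (-β)) {n : ℕ} (hn : 1 ≤ n)
    (x : P) : ‖coeffG Fp n x‖ ≤ Real.exp (2 * π) * (2 * α) * (n : ℝ) ^ β := by
  have hFEx : ∀ τ : ℍ, Fp ((2 : ℝ) +ᵥ τ) x - 2 * Fp ((1 : ℝ) +ᵥ τ) x + Fp τ x = 0 := fun τ => hFE τ x
  have h4x : ∀ τ : ℍ, |τ.re| ≤ 1 → ‖Fp τ x‖ ≤ α * τ.im ^ (-β) := fun τ hτ => h4 τ x hτ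
  rw [coeffG_eq_qExpansion_coeff hh hFE hβ h4]
  exact norm_qExpansion_coeff_le_of_strip (periodic_shiftDiff hFEx) (mdifferentiable_shiftDiff (hh x))
    (isZeroAtImInfty_shiftDiff hFEx hβ h4x).isBoundedAtImInfty
    (fun τ h0 h1 _ => by
      have := norm_shiftDiff_le hFEx h4x h0 h1
      linarith) hn

omit [NormedSpace ℝ P] in
/-- Radial fibres give radial coefficients `aₙ`. [folklore] -/
theorem isRadial_coeffA (hrad : ∀ τ, IsRadial (Fp τ)) (n : ℕ) : IsRadial (coeffA Fp n) := by
  intro x y hxy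
  simp only [coeffA]
  refine setIntegral_congr_fun measurableSet_Ioc fun u _ => ?_
  simp only [coeffKernelA, Pi.smul_apply, Pi.sub_apply, hrad _ hxy]

omit [NormedSpace ℝ P] in
/-- Radial fibres give radial coefficients `gₙ`. [folklore] -/
theorem isRadial_coeffG (hrad : ∀ τ, IsRadial (Fp τ)) (n : ℕ) : IsRadial (coeffG Fp n) := by
  intro x y hxy
  simp only [coeffG]
  refine setIntegral_congr_fun measurableSet_Ioc fun u _ => ?_
  simp only [coeffKernelG, Pi.smul_apply, Pi.sub_apply, hrad _ hxy]

/-! ## Summary: the first half of CKMRV Theorem 3.1 for a parametrised family -/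

omit [NormedAddCommGroup P] [NormedSpace ℝ P] in
/-- `(n + 1)ᵝ ≤ (1 + n)^{⌈β⌉}`. [folklore] -/
theorem rpow_succ_le_pow_ceil (β : ℝ) (n : ℕ) :
    ((n : ℝ) + 1) ^ β ≤ (1 + (n : ℝ)) ^ ⌈β⌉₊ := by
  rw [add_comm, ← Real.rpow_natCast]
  exact Real.rpow_le_rpow_of_exponent_le (by linarith [(Nat.cast_nonneg n : (0 : ℝ) ≤ n)])
    (Nat.le_ceil β)

/-- **CKMRV Theorem 3.1, first half, for one generating function** ("We begin by obtaining the
expansion of `F` … `F(τ,x) = ∑ aₙ(x) e^{2πinτ} + 2πiτ ∑ √(2n) bₙ(x) e^{2πinτ}` (3.3) … Thus `aₙ`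
and `bₙ` are Schwartz functions … these radial seminorms of `aₙ` and `bₙ` grow at most
polynomially in `n`"), in the following proved form. Let `F : ℍ × P → ℂ` (`P` a real normed space)
have smooth fibres `F(τ, ·)`, jointly continuous `x`-derivatives, holomorphic sections `F(·, x)`,
satisfy `F(τ+2,x) − 2F(τ+1,x) + F(τ,x) = 0`, the bounds (3) (Fréchet form, `HasGrowthBounds`)
and (4): `|F(τ,x)| ≤ α Im(τ)^{−β}` (`β > 0`) for `|Re τ| ≤ 1`. Then there are Schwartz functions
`aₙ, gₙ` (`n = 0, 1, …`, standing for the indices `n + 1 ≥ 1`) with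
`F(τ,x) = ∑ₙ aₙ(x) q^{n+1} + τ ∑ₙ gₙ(x) q^{n+1}` (`q = e^{2πiτ}`), both series converging (to
`H_x(τ)` and `G_x(τ)`), of at most polynomial growth in `n` at each `x`, and radial if the
fibres of `F` are; explicitly `aₙ = coeffA F (n+1)`, `gₙ = coeffG F (n+1)`. (Here
`gₙ = 2πi √(2n) bₙ` in CKMRV's notation; the seminorm growth is not recorded.)
[cite: CohnEtAl2019, §3.1 Theorem 3.1 (proof, first part)] -/
theorem exists_schwartz_coefficients (hs : ∀ τ, ContDiff ℝ ∞ (Fp τ))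
    (hc : ∀ m : ℕ, Continuous fun q : ℍ × P => iteratedFDeriv ℝ m (Fp q.1) q.2)
    (hh : ∀ x, MDiff fun τ => Fp τ x)
    (hFE : ∀ τ x, Fp ((2 : ℝ) +ᵥ τ) x - 2 * Fp ((1 : ℝ) +ᵥ τ) x + Fp τ x = 0)
    (h3 : HasGrowthBounds Fp)
    {α β : ℝ} (hβ : 0 < β) (h4 : ∀ τ x, |τ.re| ≤ 1 → ‖Fp τ x‖ ≤ α * τ.im ^ (-β)) :
    ∃ a g : ℕ → 𝓢(P, ℂ),
      (∀ (n : ℕ) (x : P), a n x = coeffA Fp (n + 1) x) ∧ (∀ (n : ℕ) (x : P), g n x = coeffG Fp (n + 1) x) ∧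
      (∀ (τ : ℍ) (x : P), HasSum (fun n : ℕ => a n x * Periodic.qParam 1 τ ^ (n + 1))
        (shiftRem (fun σ => Fp σ x) τ)) ∧
      (∀ (τ : ℍ) (x : P), HasSum (fun n : ℕ => g n x * Periodic.qParam 1 τ ^ (n + 1))
        (shiftDiff (fun σ => Fp σ x) τ)) ∧
      (∀ (τ : ℍ) (x : P), Fp τ x = (∑' n : ℕ, a n x * Periodic.qParam 1 τ ^ (n + 1)) +
        (τ : ℂ) * ∑' n : ℕ, g n x * Periodic.qParam 1 τ ^ (n + 1)) ∧
      (∀ x : P, ∃ (C : ℝ) (N : ℕ), ∀ n : ℕ, ‖a n x‖ ≤ C * (1 + n) ^ N ∧ ‖g n x‖ ≤ C * (1 + n) ^ N) ∧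
      ((∀ τ, IsRadial (Fp τ)) → ∀ n, IsRadial (a n) ∧ IsRadial (g n)) := by
  refine ⟨fun n => coeffASchwartz hs hc h3 (n + 1), fun n => coeffGSchwartz hs hc h3 (n + 1),
    fun n x => rfl, fun n x => rfl, fun τ x => ?_, fun τ x => ?_, fun τ x => ?_, fun x => ?_, fun hrad n => ?_⟩
  · have h := hasSum_shiftRem (hh x) (fun σ => hFE σ x) hβ (fun σ hσ => h4 σ x hσ) τ
    simpa only [coeffASchwartz_apply, coeffA_eq_qExpansion_coeff hh hFE hβ h4] using h
  · have h := hasSum_shiftDiff (hh x) (fun σ => hFE σ x) hβ (fun σ hσ => h4 σ x hσ) τ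
    simpa only [coeffGSchwartz_apply, coeffG_eq_qExpansion_coeff hh hFE hβ h4] using h
  · have h := eq_tsum_add_mul_tsum (hh x) (fun σ => hFE σ x) hβ (fun σ hσ => h4 σ x hσ) τ
    simpa only [coeffASchwartz_apply, coeffGSchwartz_apply, coeffA_eq_qExpansion_coeff hh hFE hβ h4,
      coeffG_eq_qExpansion_coeff hh hFE hβ h4] using h
  · have hα : 0 ≤ α := by
      have h := h4 UpperHalfPlane.I x (by simp)
      have : (0 : ℝ) < UpperHalfPlane.I.im ^ (-β) := Real.rpow_pos_of_pos (by simp) _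
      nlinarith [norm_nonneg (Fp UpperHalfPlane.I x)]
    refine ⟨Real.exp (2 * π) * (5 * α), ⌈β⌉₊, fun n => ⟨?_, ?_⟩⟩
    · refine (norm_coeffA_le hh hFE hβ h4 (by omega) x).trans ?_
      push_cast
      exact mul_le_mul_of_nonneg_left (rpow_succ_le_pow_ceil β n) (by positivity)
    · refine (norm_coeffG_le hh hFE hβ h4 (by omega) x).trans ?_
      push_cast
      calc Real.exp (2 * π) * (2 * α) * ((n : ℝ) + 1) ^ β
          ≤ Real.exp (2 * π) * (5 * α) * ((n : ℝ) + 1) ^ β := by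
            gcongr
            · norm_num
        _ ≤ Real.exp (2 * π) * (5 * α) * (1 + (n : ℝ)) ^ ⌈β⌉₊ :=
            mul_le_mul_of_nonneg_left (rpow_succ_le_pow_ceil β n) (by positivity)
  · exact ⟨isRadial_coeffA hrad (n + 1), isRadial_coeffG hrad (n + 1)⟩

end Calculus

end Literature.Analysis.Fourier
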